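import Literature.AlgebraicGeometry.Motives.HodgeStructureLefschetzGroupCenterPointsCount
import Literature.AlgebraicGeometry.Motives.HodgeStructureLefschetzGroupCenterBlocksPoints
import Literature.AlgebraicGeometry.Motives.HodgeStructureLefschetzGroupCenterIsotypic
import Literature.AlgebraicGeometry.Motives.HodgeStructureCentralizerInternalBlocksRestrictionPoints
import Mathlib.RingTheory.Spectrum.Prime.RingHom
import HarnessLib

/-!
# `#Z(S(A)(K)) = Π_S 2^{t_K(S)}` OVER THE CANONICAL BLOCKS: `S₀(K)` OF THE FIRST KIND SIMPLE FACTOR BY SIMPLE FACTOR, FOR EVERY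
# FIELD `K ⊇ ℚ`; and `t_K(H) = Σ_S t_K(S)`, `t_K(S) ≥ 1`, `t ≤ t_K` for every polarized `H`
# (Milne 1999 §1 Prop. 1.5, p. 645 `S₀(A)(R)`, Prop. 1.7, Remark 1.6; Moonen–Zarhin 1998 §1 Lemma (1))

[topic AlgebraicGeometry/Motives]

Layer `Literature/AlgebraicGeometry/Motives`, lane `lit-hodgefound` (Track 2 foundations library; prover seat
`lit-hodgefound-p02`, generation 55, self-proposed row g55-#10). THEOREMS ONLY: no definition, no named fact (net debt `0`),
no instance, no notation.  Milne reduces `S(A)` to the simple isogeny factors (Prop. 1.5 «`S(A₁) × ⋯ × S(A_s) → S(A)` is an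
isomorphism», from Prop. 1.1 `C(A) ≅ Π C(Aᵢ)`), uniformly in the coefficient field (Remark 1.6 «`S'(A) ≅ S(A)_{/k'}`»), and
describes the centre through `S₀(A)(R) = {γ ∈ C₀(A) ⊗_ℚ R | γ†γ = 1}` (p. 645, Prop. 1.7) with `C₀(A) = Π_i C₀(A_i)` a product of
fields.  The tree has the block decomposition of the centre on `K`-points (g55-#5
`Polarization.exists_center_lefschetzGroupBaseChange_mulEquiv_pi_minimal_stable`: `Z(S(H)(K)) ≃* Π_S Z(S(S)(K))` over the
canonical blocks = isotypic components = simple factors of `End⁰`) and the count `#Z(S(H)(K)) = 2^{t_K}` for `†` of the first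
kind (g55-#8 `Polarization.natCard_center_lefschetzGroupBaseChange_eq_two_pow`, `t_K = #MaxSpec Z(C(H)(K))` = the number of simple
factors of `C₀ ⊗ K`).  Here the two are combined:
(i) `#Z(S(H)(K)) = Π_S #Z(S(S)(K))` over the canonical blocks, for every field `K` (the `K`-points form of g55-#2's ℚ-count);
(ii) FIRST KIND: `#Z(S(H)(K)) = Π_S 2^{t_K(S)}` — every simple factor `S` (with its block algebra `E_φ(S)`, simple by g55-#3, and
its centre `C₀(S)`, a field) contributes the factor `#μ₂(C₀(S) ⊗ K) = 2^{t_K(S)}`, `t_K(S)` = the number of factors of the étale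
`K`-algebra `C₀(S) ⊗ K`;
(iii) FOR EVERY POLARIZED `H` (no condition on `†`): `t_K(H) = Σ_S t_K(S)` with `t_K(S) ≥ 1` for every block, hence `t ≤ t_K`
— restriction `C(H)(K) ≅ Π_S C(S)(K)` (Prop. 1.1 on `K`-points, the tree's `exists_algEquiv_pi_centralizer_baseChange_of_forall_stable`)
induces `Z(C(H)(K)) ≅ Π_S Z(C(S)(K))`, and `MaxSpec` of a finite product of Artinian rings is the disjoint union.

## The sources, verbatim

* J. S. Milne, *Lefschetz classes on abelian varieties*, Duke Math. J. 96 (1999) 639–675 [Milne1999LefschetzClasses] (held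
  `paper:doi-10-1215-s0012-7094-99-09620-5`): folio 6 = p. 644 «Proposition 1.5. Let `A₁, …, A_s` be a set of representatives
  for the simple isogeny factors of `A` … Any such isogeny induces an isomorphism `S(A₁) × ⋯ × S(A_s) → S(A)`, which is
  independent of the choice of the isogeny.» and Remark 1.6 «`C'(A) ≅ C(A) ⊗_k k'`, `S'(A) ≅ S(A)_{/k'}`»; folio 7 = p. 645 L1–L14
  «`C₀(A)` … is a product of fields … `S₀(A)(R) = {γ ∈ C₀(A) ⊗_ℚ R | γ†γ = 1}` … Proposition 1.7 … an isomorphism of algebraic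
  groups `S₀(A)_{/ℚ_ℓ} → S_ℓ(A)`»; §2 Summary p. 652.
* B. J. J. Moonen, Yu. G. Zarhin, *Weil classes on abelian varieties*, J. reine angew. Math. 496 (1998) 83–92
  [MoonenZarhin1998WeilClasses] (held `paper:arxiv-alg-geom_9612017`, chunk p0002 L121–L127): «Lemma. (1) The center of
  `G_div(X)` is the group `U_{K_B}` … in all other cases it is finite.»
* H. Lange, *Abelian Varieties over the Complex Numbers* (2023) [Lange2023AbelianVarietiesComplex], §2.4.4 Cor. 2.4.26, §2.6.2
  Lemma 2.6.4.

Nearest tree results, BY NAME: g55-#5 `Polarization.exists_center_lefschetzGroupBaseChange_mulEquiv_pi_minimal_stable`; g55-#8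
`Polarization.natCard_center_lefschetzGroupBaseChange_eq_two_pow`, `Polarization.natCard_minimal_stable_le_natCard_maximalSpectrum`;
g55-#3 `Polarization.forall_adjoint_center_eq_self_iff_forall_minimal_stable`, `isSimpleRing_endAlg_of_minimal_stable`,
`natCard_minimal_stable_eq_one_iff_isSimpleRing_endAlg`; g55-#2 `Polarization.natCard_center_lefschetzGroup_eq_prod_minimal_stable`
(the case `K = ℚ` of (i)).

## Dictionary and what is proved (namespace `Literature.AlgebraicGeometry.Motives.HodgeStructure`)

`S(H)(K) = ψ.lefschetzGroupBaseChange K`, `S(S)(K) = (ψ.restrict S).lefschetzGroupBaseChange K`, `Z_K(S) = Z(C(S)(K))`,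
`t_K(S) = Nat.card (MaximalSpectrum Z_K(S))`; "canonical block" = minimal non-zero `E_φ`-stable sub-Hodge structure (the finite
set `ψ.finite_setOf_minimal_stable`); "first kind" = `∀ z ∈ Z(E_φ), z† = z`.

* §1 **`Polarization.natCard_center_lefschetzGroupBaseChange_eq_prod_minimal_stable`** (`#Z(S(H)(K)) = Π_S #Z(S(S)(K))`, every `K`).
* §2 **`Polarization.natCard_center_lefschetzGroupBaseChange_restrict_eq_two_pow`** (first kind, `S` canonical:
  `#Z(S(S)(K)) = 2^{t_K(S)}`), **`Polarization.natCard_center_lefschetzGroupBaseChange_eq_prod_two_pow`** (`#Z(S(H)(K)) = Π_S 2^{t_K(S)}`).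
* §3 (no condition on `†`) **`Polarization.natCard_maximalSpectrum_center_centralizer_eq_sum_minimal_stable`**
  (`t_K(H) = Σ_S t_K(S)`), **`one_le_natCard_maximalSpectrum_center_centralizer`** (`V ≠ 0 ⟹ t_K ≥ 1`),
  **`one_le_natCard_maximalSpectrum_center_centralizer_of_ne_bot`** (`t_K(S) ≥ 1`),
  **`Polarization.card_toFinset_minimal_stable_le_natCard_maximalSpectrum`** (`t ≤ t_K`).
-/

noncomputable section

open scoped TensorProduct

namespace Literature.AlgebraicGeometry.Motives

namespace HodgeStructure

universe u uK

variable (K : Type uK) [Field K] [Algebra ℚ K] {V : Type u} [AddCommGroup V] [Module ℚ V] [Module.Finite ℚ V] {n : ℤ}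
  {H : HodgeStructure V n}

/-! ## §1 `#Z(S(H)(K)) = Π_S #Z(S(S)(K))` over the canonical blocks -/

open Classical in
set_option maxSynthPendingDepth 4 in
/-- **`#Z(S(H)(K)) = Π_{S canonical} #Z(S(S, ψ|_S)(K))` FOR EVERY FIELD `K ⊇ ℚ`** (as `Nat.card`, over the finitely many canonical
blocks; g55-#5's `Z(S(H)(K)) ≃* Π_S Z(S(S)(K))` counted) — Prop. 1.5 on the centre, on `K`-points.
[cite: Milne1999LefschetzClasses, §1 Prop. 1.5, Remark 1.6 (p. 644), p. 645 L1–L14 and §2 Summary p. 652] [cite: MoonenZarhin1998WeilClasses, §1 Lemma (1)] -/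
theorem Polarization.natCard_center_lefschetzGroupBaseChange_eq_prod_minimal_stable (ψ : Polarization H) :
    Nat.card (Subgroup.center (ψ.lefschetzGroupBaseChange K)) =
      ∏ S ∈ ψ.finite_setOf_minimal_stable.toFinset,
        Nat.card (Subgroup.center ((ψ.restrict S).lefschetzGroupBaseChange K)) := by
  obtain ⟨f, -⟩ := ψ.exists_center_lefschetzGroupBaseChange_mulEquiv_pi_minimal_stable K
  haveI : Fintype {S : SubHodgeStructure H // (∀ a ∈ H.endAlg, ∀ v ∈ S.toSubmodule, a v ∈ S.toSubmodule) ∧ S.toSubmodule ≠ ⊥ ∧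
      ∀ S' : SubHodgeStructure H, (∀ a ∈ H.endAlg, ∀ v ∈ S'.toSubmodule, a v ∈ S'.toSubmodule) →
        S'.toSubmodule ≤ S.toSubmodule → S'.toSubmodule = ⊥ ∨ S'.toSubmodule = S.toSubmodule} :=
    ψ.finite_setOf_minimal_stable.fintype
  rw [Nat.card_congr f.toEquiv, Nat.card_pi, ← Finset.prod_subtype ψ.finite_setOf_minimal_stable.toFinset
    (fun S => by rw [Set.Finite.mem_toFinset]; rfl)
    (fun S => Nat.card (Subgroup.center ((ψ.restrict S).lefschetzGroupBaseChange K)))]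

/-! ## §2 First kind: every simple factor contributes `2^{t_K(S)}` -/

set_option maxSynthPendingDepth 4 in
/-- **FIRST KIND, `S` A CANONICAL BLOCK: `#Z(S(S)(K)) = 2^{t_K(S)}`**, `t_K(S)` = the number of simple factors of `C₀(S) ⊗ K`
(`C₀(S) = Z(E_φ(S))` a field, `E_φ(S)` simple by g55-#3): `†` of the first kind is of the first kind on every block (g55-#3
`Polarization.forall_adjoint_center_eq_self_iff_forall_minimal_stable`), and g55-#8 counts `Z(S(S)(K)) = μ₂(C₀(S) ⊗ K)`.
[cite: Milne1999LefschetzClasses, §1 Prop. 1.5, Remark 1.6 (p. 644) and p. 645 L1–L14 (S₀, Prop. 1.7)] [cite: MoonenZarhin1998WeilClasses, §1 Lemma (1)] -/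
theorem Polarization.natCard_center_lefschetzGroupBaseChange_restrict_eq_two_pow (ψ : Polarization H)
    (hfix : ∀ z : H.endAlg, z ∈ Subalgebra.center ℚ H.endAlg → ψ.adjoint (z : Module.End ℚ V) = z) {S : SubHodgeStructure H}
    (hS : (∀ a ∈ H.endAlg, ∀ v ∈ S.toSubmodule, a v ∈ S.toSubmodule) ∧ S.toSubmodule ≠ ⊥ ∧
      ∀ S' : SubHodgeStructure H, (∀ a ∈ H.endAlg, ∀ v ∈ S'.toSubmodule, a v ∈ S'.toSubmodule) →
        S'.toSubmodule ≤ S.toSubmodule → S'.toSubmodule = ⊥ ∨ S'.toSubmodule = S.toSubmodule) :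
    Nat.card (Subgroup.center ((ψ.restrict S).lefschetzGroupBaseChange K)) =
      2 ^ Nat.card (MaximalSpectrum (Subalgebra.center K (Subalgebra.centralizer K
        ((fun a : Module.End ℚ S.toSubmodule => a.baseChange K) ''
          (S.toHodgeStructure.endAlg : Set (Module.End ℚ S.toSubmodule)))))) :=
  (ψ.restrict S).natCard_center_lefschetzGroupBaseChange_eq_two_pow K
    ((ψ.forall_adjoint_center_eq_self_iff_forall_minimal_stable.1 hfix) S hS)

open Classical in
set_option maxSynthPendingDepth 4 in
/-- **FIRST KIND: `#Z(S(A)(K)) = Π_{S canonical} 2^{t_K(S)}` FOR EVERY FIELD `K ⊇ ℚ`** — `S₀(K) = Π_i μ₂(C₀(A_i) ⊗ K)` over the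
simple factors (Prop. 1.5 with `S₀(A)(R) = {γ ∈ C₀ ⊗ R | γ†γ = 1}`, `C₀ = Π_i C₀(A_i)`). [cite: Milne1999LefschetzClasses, §1 Prop. 1.5, Remark 1.6 (p. 644), p. 645 L1–L14 (S₀, Prop. 1.7) and §2 Summary p. 652]
[cite: MoonenZarhin1998WeilClasses, §1 Lemma (1)] [cite: Lange2023AbelianVarietiesComplex, §2.4.4 Cor. 2.4.26 and §2.6.2 Lemma 2.6.4] -/
theorem Polarization.natCard_center_lefschetzGroupBaseChange_eq_prod_two_pow (ψ : Polarization H)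
    (hfix : ∀ z : H.endAlg, z ∈ Subalgebra.center ℚ H.endAlg → ψ.adjoint (z : Module.End ℚ V) = z) :
    Nat.card (Subgroup.center (ψ.lefschetzGroupBaseChange K)) =
      ∏ S ∈ ψ.finite_setOf_minimal_stable.toFinset,
        2 ^ Nat.card (MaximalSpectrum (Subalgebra.center K (Subalgebra.centralizer K
          ((fun a : Module.End ℚ S.toSubmodule => a.baseChange K) ''
            (S.toHodgeStructure.endAlg : Set (Module.End ℚ S.toSubmodule)))))) := by
  rw [ψ.natCard_center_lefschetzGroupBaseChange_eq_prod_minimal_stable K]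
  refine Finset.prod_congr rfl fun S hS => ?_
  rw [Set.Finite.mem_toFinset] at hS
  exact ψ.natCard_center_lefschetzGroupBaseChange_restrict_eq_two_pow K hfix hS

/-! ## §3 `t_K(H) = Σ_S t_K(S)` for every polarizable `H` (no condition on `†`), every block contributing `t_K(S) ≥ 1` -/

omit [Algebra ℚ K] [Module.Finite ℚ V] in
/-- **THE CENTRE OF A PRODUCT**: an isomorphism of `K`-algebras `A ≅ Π_i B_i` induces a ring isomorphism `Z(A) ≅ Π_i Z(B_i)`.
[folklore] -/
private theorem nonempty_center_ringEquiv_pi₅₅₁₀ {A : Type*} [Ring A] [Algebra K A] {ι : Type*} {B : ι → Type*}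
    [∀ i, Ring (B i)] [∀ i, Algebra K (B i)] (E : A ≃ₐ[K] Π i, B i) :
    Nonempty (Subalgebra.center K A ≃+* Π i, Subalgebra.center K (B i)) := by
  classical
  have hmem : ∀ (z : Subalgebra.center K A) (i : ι), E (z : A) i ∈ Subalgebra.center K (B i) := fun z i =>
    Subalgebra.mem_center_iff.2 fun b => by
      have h := congrArg (fun x => E x i) (Subalgebra.mem_center_iff.1 z.2 (E.symm (Pi.single i b)))
      simp only [map_mul, AlgEquiv.apply_symm_apply, Pi.mul_apply, Pi.single_eq_same] at h
      exact h
  have hmem' : ∀ w : Π i, Subalgebra.center K (B i), E.symm (fun i => (w i : B i)) ∈ Subalgebra.center K A := fun w =>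
    Subalgebra.mem_center_iff.2 fun a => E.injective (by
      rw [map_mul, map_mul, AlgEquiv.apply_symm_apply]
      funext i
      rw [Pi.mul_apply, Pi.mul_apply]
      exact Subalgebra.mem_center_iff.1 (w i).2 (E a i))
  exact ⟨{ toFun := fun z i => ⟨E (z : A) i, hmem z i⟩,
           invFun := fun w => ⟨E.symm (fun i => (w i : B i)), hmem' w⟩,
           left_inv := fun z => Subtype.ext (E.symm_apply_apply (z : A)),
           right_inv := fun w => funext fun i => Subtype.ext (by
             change E (E.symm fun i => (w i : B i)) i = (w i : B i)
             rw [AlgEquiv.apply_symm_apply]),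
           map_mul' := fun z z' => funext fun i => Subtype.ext (by
             change E ((z : A) * (z' : A)) i = E (z : A) i * E (z' : A) i
             rw [map_mul, Pi.mul_apply]),
           map_add' := fun z z' => funext fun i => Subtype.ext (by
             change E ((z : A) + (z' : A)) i = E (z : A) i + E (z' : A) i
             rw [map_add, Pi.add_apply]) }⟩

omit [Algebra ℚ K] [Module.Finite ℚ V] in
/-- **MAXIMAL IDEALS OF A FINITE PRODUCT OF ARTINIAN RINGS**: `#MaxSpec(Z) = Σ_i #MaxSpec(R_i)` along `Z ≅ Π_i R_i` (prime =
maximal in Artinian rings; `Spec(Π_i R_i) = ⊔_i Spec(R_i)`, Mathlib's `PrimeSpectrum.sigmaToPi_bijective`). [folklore] -/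
private theorem natCard_maximalSpectrum_eq_sum_of_ringEquiv₅₅₁₀ {Z : Type*} [CommRing Z] [IsArtinianRing Z] {ι : Type*}
    [Fintype ι] {R : ι → Type*} [∀ i, CommRing (R i)] [∀ i, IsArtinianRing (R i)] (e : Z ≃+* Π i, R i) :
    Nat.card (MaximalSpectrum Z) = ∑ i, Nat.card (MaximalSpectrum (R i)) := by
  rw [← Nat.card_congr (IsArtinianRing.primeSpectrumEquivMaximalSpectrum (R := Z)),
    Nat.card_congr (PrimeSpectrum.comapEquiv e).toEquiv,
    ← Nat.card_congr (Equiv.ofBijective _ (PrimeSpectrum.sigmaToPi_bijective R)), Nat.card_sigma]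
  exact Finset.sum_congr rfl fun i _ => Nat.card_congr (IsArtinianRing.primeSpectrumEquivMaximalSpectrum (R := R i))

set_option maxSynthPendingDepth 4 in
/-- `Z_K = Z(C(H)(K))` is a finite-dimensional, hence Artinian, commutative `K`-algebra. [folklore] -/
private theorem isArtinianRing_center_centralizer₅₅₁₀ :
    IsArtinianRing (Subalgebra.center K (Subalgebra.centralizer K
      ((fun a : Module.End ℚ V => a.baseChange K) '' (H.endAlg : Set (Module.End ℚ V))))) := by
  haveI := finite_centralizer_endAlg_baseChange K H
  haveI : IsNoetherian K (Subalgebra.centralizer K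
      ((fun a : Module.End ℚ V => a.baseChange K) '' (H.endAlg : Set (Module.End ℚ V)))) :=
    isNoetherian_of_isNoetherianRing_of_finite K _
  haveI : Module.Finite K (Subalgebra.center K (Subalgebra.centralizer K
      ((fun a : Module.End ℚ V => a.baseChange K) '' (H.endAlg : Set (Module.End ℚ V))))) :=
    Module.Finite.of_injective (Subalgebra.val _).toLinearMap Subtype.val_injective
  exact IsArtinianRing.of_finite K _

open Classical in
set_option maxSynthPendingDepth 4 in
/-- **`t_K(H) = Σ_{S canonical} t_K(S)` FOR EVERY POLARIZED `H` AND EVERY FIELD `K ⊇ ℚ`** (no condition on `†`): the simple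
factors of `Z(C(H)(K)) = C₀ ⊗ K` are distributed over the simple factors of `End⁰` — restriction to the canonical blocks is an
isomorphism `C(H)(K) ≅ Π_S C(S)(K)` of `K`-algebras (Prop. 1.1 on `K`-points, the tree's
`exists_algEquiv_pi_centralizer_baseChange_of_forall_stable`), hence `Z(C(H)(K)) ≅ Π_S Z(C(S)(K))` and
`MaxSpec = ⊔_S MaxSpec`. [cite: Milne1999LefschetzClasses, §1 Prop. 1.1 (p. 643), Prop. 1.5, Remark 1.6 (p. 644) and p. 645 L1–L6]
[cite: Lange2023AbelianVarietiesComplex, §2.4.4 Cor. 2.4.26] -/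
theorem Polarization.natCard_maximalSpectrum_center_centralizer_eq_sum_minimal_stable (ψ : Polarization H) :
    Nat.card (MaximalSpectrum (Subalgebra.center K (Subalgebra.centralizer K
        ((fun a : Module.End ℚ V => a.baseChange K) '' (H.endAlg : Set (Module.End ℚ V)))))) =
      ∑ S ∈ ψ.finite_setOf_minimal_stable.toFinset,
        Nat.card (MaximalSpectrum (Subalgebra.center K (Subalgebra.centralizer K
          ((fun a : Module.End ℚ S.toSubmodule => a.baseChange K) ''
            (S.toHodgeStructure.endAlg : Set (Module.End ℚ S.toSubmodule)))))) := by
  haveI : Fintype {S : SubHodgeStructure H // (∀ a ∈ H.endAlg, ∀ v ∈ S.toSubmodule, a v ∈ S.toSubmodule) ∧ S.toSubmodule ≠ ⊥ ∧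
      ∀ S' : SubHodgeStructure H, (∀ a ∈ H.endAlg, ∀ v ∈ S'.toSubmodule, a v ∈ S'.toSubmodule) →
        S'.toSubmodule ≤ S.toSubmodule → S'.toSubmodule = ⊥ ∨ S'.toSubmodule = S.toSubmodule} :=
    ψ.finite_setOf_minimal_stable.fintype
  obtain ⟨E, -⟩ := exists_algEquiv_pi_centralizer_baseChange_of_forall_stable K
    (Subtype.val : {S : SubHodgeStructure H // (∀ a ∈ H.endAlg, ∀ v ∈ S.toSubmodule, a v ∈ S.toSubmodule) ∧ S.toSubmodule ≠ ⊥ ∧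
      ∀ S' : SubHodgeStructure H, (∀ a ∈ H.endAlg, ∀ v ∈ S'.toSubmodule, a v ∈ S'.toSubmodule) →
        S'.toSubmodule ≤ S.toSubmodule → S'.toSubmodule = ⊥ ∨ S'.toSubmodule = S.toSubmodule} → SubHodgeStructure H)
    ψ.isInternal_minimal_stable fun S => S.2.1
  obtain ⟨e⟩ := nonempty_center_ringEquiv_pi₅₅₁₀ K E
  haveI := isArtinianRing_center_centralizer₅₅₁₀ K (H := H)
  haveI : ∀ S : {S : SubHodgeStructure H // (∀ a ∈ H.endAlg, ∀ v ∈ S.toSubmodule, a v ∈ S.toSubmodule) ∧ S.toSubmodule ≠ ⊥ ∧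
      ∀ S' : SubHodgeStructure H, (∀ a ∈ H.endAlg, ∀ v ∈ S'.toSubmodule, a v ∈ S'.toSubmodule) →
        S'.toSubmodule ≤ S.toSubmodule → S'.toSubmodule = ⊥ ∨ S'.toSubmodule = S.toSubmodule},
      IsArtinianRing (Subalgebra.center K (Subalgebra.centralizer K
        ((fun a : Module.End ℚ (S : SubHodgeStructure H).toSubmodule => a.baseChange K) ''
          ((S : SubHodgeStructure H).toHodgeStructure.endAlg : Set (Module.End ℚ (S : SubHodgeStructure H).toSubmodule))))) :=
    fun S => isArtinianRing_center_centralizer₅₅₁₀ K (H := (S : SubHodgeStructure H).toHodgeStructure)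
  rw [natCard_maximalSpectrum_eq_sum_of_ringEquiv₅₅₁₀ e, ← Finset.sum_subtype ψ.finite_setOf_minimal_stable.toFinset
    (fun S => by rw [Set.Finite.mem_toFinset]; rfl)
    (fun S => Nat.card (MaximalSpectrum (Subalgebra.center K (Subalgebra.centralizer K
      ((fun a : Module.End ℚ S.toSubmodule => a.baseChange K) '' (S.toHodgeStructure.endAlg : Set (Module.End ℚ S.toSubmodule)))))))]

set_option maxSynthPendingDepth 4 in
/-- **`t_K ≥ 1` FOR `V ≠ 0`**: the commutative `K`-algebra `Z(C(H)(K)) ⊆ End_K(K ⊗ V)` is non-zero, so it has a maximal ideal — in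
particular every canonical block contributes at least one simple factor of `C₀ ⊗ K`. [cite: Milne1999LefschetzClasses, §1 Remark 1.6 (p. 644) and p. 645 L1–L6] -/
theorem one_le_natCard_maximalSpectrum_center_centralizer [Nontrivial V] :
    1 ≤ Nat.card (MaximalSpectrum (Subalgebra.center K (Subalgebra.centralizer K
        ((fun a : Module.End ℚ V => a.baseChange K) '' (H.endAlg : Set (Module.End ℚ V)))))) := by
  have hpos : 0 < Module.finrank K (K ⊗[ℚ] V) := by
    rw [Module.finrank_baseChange]
    exact Module.finrank_pos
  haveI := Module.nontrivial_of_finrank_pos hpos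
  haveI : Nontrivial (Subalgebra.center K (Subalgebra.centralizer K
      ((fun a : Module.End ℚ V => a.baseChange K) '' (H.endAlg : Set (Module.End ℚ V))))) :=
    ⟨⟨0, 1, fun h => zero_ne_one (congrArg (fun z : Subalgebra.center K (Subalgebra.centralizer K
      ((fun a : Module.End ℚ V => a.baseChange K) '' (H.endAlg : Set (Module.End ℚ V)))) =>
        ((z : Subalgebra.centralizer K ((fun a : Module.End ℚ V => a.baseChange K) ''
          (H.endAlg : Set (Module.End ℚ V)))) : Module.End K (K ⊗[ℚ] V))) h)⟩⟩
  obtain ⟨M, hM⟩ := Ideal.exists_maximal (Subalgebra.center K (Subalgebra.centralizer K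
      ((fun a : Module.End ℚ V => a.baseChange K) '' (H.endAlg : Set (Module.End ℚ V)))))
  haveI : Nonempty (MaximalSpectrum (Subalgebra.center K (Subalgebra.centralizer K
      ((fun a : Module.End ℚ V => a.baseChange K) '' (H.endAlg : Set (Module.End ℚ V)))))) := ⟨⟨M, hM⟩⟩
  haveI := finite_maximalSpectrum_center_centralizer_endAlg_baseChange K (H := H)
  exact Nat.card_pos

set_option maxSynthPendingDepth 4 in
/-- **EVERY CANONICAL BLOCK CONTRIBUTES AT LEAST ONE FACTOR: `t_K(S) ≥ 1`.** [cite: Milne1999LefschetzClasses, §1 Prop. 1.5, Remark 1.6 (p. 644) and p. 645 L1–L6] -/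
theorem one_le_natCard_maximalSpectrum_center_centralizer_of_ne_bot {S : SubHodgeStructure H} (hS : S.toSubmodule ≠ ⊥) :
    1 ≤ Nat.card (MaximalSpectrum (Subalgebra.center K (Subalgebra.centralizer K
        ((fun a : Module.End ℚ S.toSubmodule => a.baseChange K) ''
          (S.toHodgeStructure.endAlg : Set (Module.End ℚ S.toSubmodule)))))) := by
  haveI : Nontrivial S.toSubmodule := Submodule.nontrivial_iff_ne_bot.2 hS
  exact one_le_natCard_maximalSpectrum_center_centralizer K (H := S.toHodgeStructure)

open Classical in
set_option maxSynthPendingDepth 4 in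
/-- **`t ≤ t_K` FOR EVERY POLARIZED `H`** (no condition on `†`; g55-#8 `Polarization.natCard_minimal_stable_le_natCard_maximalSpectrum`
is the first-kind case through the group count): the number of simple factors of `End⁰` is at most the number of simple factors
of `C₀ ⊗ K`, each block contributing `t_K(S) ≥ 1` of them. [cite: Milne1999LefschetzClasses, §1 Prop. 1.5, Remark 1.6 (p. 644) and p. 645 L1–L6]
[cite: Lange2023AbelianVarietiesComplex, §2.4.4 Cor. 2.4.26] -/
theorem Polarization.card_toFinset_minimal_stable_le_natCard_maximalSpectrum (ψ : Polarization H) :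
    ψ.finite_setOf_minimal_stable.toFinset.card ≤
      Nat.card (MaximalSpectrum (Subalgebra.center K (Subalgebra.centralizer K
        ((fun a : Module.End ℚ V => a.baseChange K) '' (H.endAlg : Set (Module.End ℚ V)))))) := by
  rw [ψ.natCard_maximalSpectrum_center_centralizer_eq_sum_minimal_stable K, Finset.card_eq_sum_ones]
  refine Finset.sum_le_sum fun S hS => ?_
  rw [Set.Finite.mem_toFinset] at hS
  exact one_le_natCard_maximalSpectrum_center_centralizer_of_ne_bot K hS.2.1

end HodgeStructure

end Literature.AlgebraicGeometry.Motives
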